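import Mathlib.LinearAlgebra.BilinearForm.Orthogonal
import Literature.AlgebraicGeometry.Motives.WeilFormMeyerSignature
import HarnessLib

/-!
# Aiming arithmetic: the free polarisation weights make `E ⊕ ⟨m₁ r₁, -m₂ r₂⟩` hyperbolic

The registered aiming-arithmetic stub of the line `generic-ppav-secant-descent` for the crux
`Summit.HodgeConjecture.HodgeConjecture.Theses.HeckePrymWeil.WeilTenfoldsSqrtMinus11`
(item stmt-HodgeConjecture-1262), proved for EVERY `d > 0` as
`exists_isotropic_of_signature_eq` and specialised to `d = 11` (the last theorem below; the
sibling cruxes 1260 / `WeilTwelvefoldsSqrtMinus7` need `d = 7`, the same one-line specialisation).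

Statement. `K` a field, `α ∈ K`, `α² = -d`, `K = ℚ + ℚ α`; `V` a `K`-space of dimension `2n`;
`E` an alternating `ℚ`-bilinear form on `V` of Weil type (`E(α x, α y) = d E(x, y)`) whose
symmetric form `S(x, y) = E(x, α y)` (the rational part of van Geemen's Hermitian form `H`,
LNM 1594, Lemma 5.2) is positive definite on a `K`-subspace `P` and negative definite on a
`K`-subspace `N`, both of `K`-dimension `n`, `P ⊓ N = 0` (signature `(n, n)`). Then for all
rationals `r₁, r₂` of the same sign there are positive integers `m₁, m₂` and a `K`-subspace
`L ⊆ V × K²` of `K`-dimension `n + 1` on which `E ⊕ E_c`, `E_c = diagWeilForm` with weights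
`c = (m₁ r₁, -m₂ r₂)` in the standard basis of `K²`, vanishes identically (the sum is HYPERBOLIC).

Proof (Landherr's classification replaced by Meyer's theorem, `meyer_holds`, and definite-space
bookkeeping; no discriminants; the lemmas are `Literature/AlgebraicGeometry/Motives/` +
`WeilFormIsotropicExtension`, `WeilFormMeyerSignature`). (1) `Q := P^⊥` (for `E`, equivalently
for `S`) is an `α`-stable complement of `P` (`isCompl_orthogonal_iff_disjoint`) on which `S` is
NEGATIVE definite: a vector `v ∈ Q ∖ 0` with `S(v, v) ≥ 0` would give `dim_K (P + K v) = n + 1`,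
so `(P + K v) ∩ N ∋ w ≠ 0` with `S(w, w) = S(p, p) + Nm(c) S(v, v) ≥ 0`
(`weilForm_neg_of_orthogonal`). (2) Induction (`exists_isotropic_aux`): for `α`-stable, mutually
orthogonal, positive/negative definite `ℚ`-subspaces `P, Q` of dimensions `≥ 2k + 2` there are
weights and a totally isotropic `L` of `K`-dimension `k + 2` inside `(P + Q) × K²`. Base `k = 0`:
`p₀ ∈ P`, `q₀ ∈ Q` non-zero, `x = S(p₀, p₀) > 0`, `y = -S(q₀, q₀) > 0`; choose `m₁, m₂` and
`s, s' ∈ ℚ²` with `x + Σ cᵢ sᵢ² = 0`, `-y + Σ cᵢ s'ᵢ² = 0`, `Σ cᵢ sᵢ s'ᵢ = 0`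
(`exists_aimingWeights`: `m r t² = x` is solvable in `m ∈ ℕ`, `t ∈ ℚ`), and
`L = K (p₀, s) + K (q₀, s')`. Step: `P ⊕ Q` has `ℚ`-dimension `≥ 8 ≥ 5`, `S` is non-degenerate
and indefinite on it, so MEYER gives an isotropic `p₀ + q₀ ≠ 0` (`weilForm_exists_isotropic_pair`),
i.e. `S(p₀, p₀) = -S(q₀, q₀) > 0`; recurse on the `K`-orthogonal complements `P' ⊆ P` of `p₀` and
`Q' ⊆ Q` of `q₀` (`ℚ`-codimension `≤ 2`) and add the isotropic vector `(p₀ + q₀, 0)`, orthogonal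
to `(P' + Q') × K²` (`weilForm_isotropic_span_sup`, `finrank_span_singleton_sup_eq`). (3) `n = 0`:
`L = K (0, (σ, 1))` with `m₁ σ² r₁ = r₂`, `m₂ = 1`.

References: B. van Geemen, LNM 1594 (1994), Lemma 5.2, 5.4 [vanGeemen1994HodgeAV]; J.-P. Serre,
A Course in Arithmetic, Ch. IV §3.2 Cor. 2 (Meyer) [Serre1973]; W. Landherr, Abh. Math. Sem.
Hamburg 11 (1936) (the classification this replaces; not used).
-/

noncomputable section

open Module
open Literature.AlgebraicGeometry.Motives

namespace Summit.HodgeConjecture.HodgeConjecture.Theorems.HeckePrymWeil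

universe u

variable {K : Type u} [Field K] [Algebra ℚ K] {α : K} {d : ℚ}
variable {V : Type u} [AddCommGroup V] [Module ℚ V] [Module K V] [IsScalarTower ℚ K V]

/-! ### The induction -/

/-- **Matched orthogonal extraction (induction on `k`).** For `α`-stable `ℚ`-subspaces `P, Q` of
`V`, `S` positive definite on `P`, negative definite on `Q`, `E(P, Q) = 0`, both of
`ℚ`-dimension `≥ 2k + 2`, and rationals `r₁ r₂ > 0`: there are positive integers `m₁, m₂` and a
`K`-submodule `L ⊆ (P + Q) × K²` of `K`-dimension `k + 2` on which `E ⊕ E_{(m₁ r₁, -m₂ r₂)}`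
vanishes identically. [folklore] -/
theorem exists_isotropic_aux [Module.Finite K V] [FiniteDimensional ℚ V] (hd : 0 < d)
    (hα : α * α = algebraMap ℚ K (-d))
    (hK : ∀ k : K, ∃ a b : ℚ, k = algebraMap ℚ K a + algebraMap ℚ K b * α)
    (E : LinearMap.BilinForm ℚ V) (hE : ∀ x y : V, E x y = -E y x)
    (hW : ∀ x y : V, E (α • x) (α • y) = d * E x y) {r₁ r₂ : ℚ} (hr : 0 < r₁ * r₂) (k : ℕ) :
    ∀ P Q : Submodule ℚ V, (∀ x ∈ P, α • x ∈ P) → (∀ x ∈ Q, α • x ∈ Q) →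
      (∀ x ∈ P, x ≠ 0 → 0 < E x (α • x)) → (∀ x ∈ Q, x ≠ 0 → E x (α • x) < 0) →
      (∀ p ∈ P, ∀ q ∈ Q, E p q = 0) → 2 * k + 2 ≤ finrank ℚ P → 2 * k + 2 ≤ finrank ℚ Q →
      ∃ m₁ m₂ : ℕ, 0 < m₁ ∧ 0 < m₂ ∧ ∃ L : Submodule K (V × (Fin 2 → K)),
        finrank K L = k + 2 ∧ (∀ x ∈ L, ∃ p ∈ P, ∃ q ∈ Q, x.1 = p + q) ∧
        ∀ x ∈ L, ∀ y ∈ L, bilinOrthSum E (diagWeilForm hd hα hK (Pi.basisFun K (Fin 2))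
          ![(m₁ : ℚ) * r₁, -((m₂ : ℚ) * r₂)]) x y = 0 := by
  induction k with
  | zero =>
    intro P Q hPα hQα hpos hneg hPQ hP hQ
    have hPQ0 : ∀ x ∈ P, x ∈ Q → x = 0 := fun x hxP hxQ => by
      by_contra h
      have h1 := hpos x hxP h
      rw [hPQ x hxP _ (hQα x hxQ)] at h1
      exact lt_irrefl _ h1
    obtain ⟨p₀, hp₀, hp₀0⟩ := (Submodule.ne_bot_iff P).1 fun h => by
      rw [h, finrank_bot] at hP
      omega
    obtain ⟨q₀, hq₀, hq₀0⟩ := (Submodule.ne_bot_iff Q).1 fun h => by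
      rw [h, finrank_bot] at hQ
      omega
    obtain ⟨m₁, m₂, hm₁, hm₂, s, s', h1, h2, h3⟩ :=
      exists_aimingWeights (hpos p₀ hp₀ hp₀0) (neg_pos.2 (hneg q₀ hq₀ hq₀0)) hr
    refine ⟨m₁, m₂, hm₁, hm₂, ?_⟩
    set cw : Fin 2 → ℚ := ![(m₁ : ℚ) * r₁, -((m₂ : ℚ) * r₂)] with hcw
    set T := bilinOrthSum E (diagWeilForm hd hα hK (Pi.basisFun K (Fin 2)) cw) with hT
    have hTa := bilinOrthSum_diagWeilForm_swap hd hα hK E cw hE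
    have hTw := bilinOrthSum_diagWeilForm_smul_smul hd hα hK E cw hW
    set g₁ : V × (Fin 2 → K) := (p₀, fun i => algebraMap ℚ K (s i)) with hg₁
    set g₂ : V × (Fin 2 → K) := (q₀, fun i => algebraMap ℚ K (s' i)) with hg₂
    have hg₁0 : g₁ ≠ 0 := fun h => hp₀0 (congrArg Prod.fst h)
    have hg₂0 : g₂ ≠ 0 := fun h => hq₀0 (congrArg Prod.fst h)
    have hv2 : T g₂ (α • g₂) = 0 := by
      rw [hT, hg₂, bilinOrthSum_diagWeilForm_ratVec_alpha]
      linarith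
    have hv1 : T g₁ (α • g₁) = 0 := by
      rw [hT, hg₁, bilinOrthSum_diagWeilForm_ratVec_alpha]
      linarith
    have hv3 : T g₁ g₂ = 0 := by
      rw [hT, hg₁, hg₂, bilinOrthSum_diagWeilForm_ratVec, hPQ p₀ hp₀ q₀ hq₀]
    have hv4 : T g₁ (α • g₂) = 0 := by
      rw [hT, hg₁, hg₂, bilinOrthSum_diagWeilForm_ratVec_alpha, hPQ p₀ hp₀ _ (hQα q₀ hq₀), h3,
        add_zero]
    refine ⟨Submodule.span K {g₁} ⊔ Submodule.span K {g₂}, ?_, ?_, ?_⟩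
    · rw [finrank_span_singleton_sup_eq _ hg₁0, finrank_span_singleton hg₂0]
      intro c hc
      obtain ⟨c', hc'⟩ := Submodule.mem_span_singleton.1 hc
      have e1 : c' • q₀ = c • p₀ := congrArg Prod.fst hc'
      have e2 : c • p₀ = 0 :=
        hPQ0 _ (kSmul_mem_of_alpha_smul_mem hK P hPα c hp₀)
          (e1 ▸ kSmul_mem_of_alpha_smul_mem hK Q hQα c' hq₀)
      exact (smul_eq_zero.1 e2).resolve_right hp₀0
    · intro x hx
      obtain ⟨y, hy, z, hz, rfl⟩ := Submodule.mem_sup.1 hx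
      obtain ⟨c, rfl⟩ := Submodule.mem_span_singleton.1 hy
      obtain ⟨c', rfl⟩ := Submodule.mem_span_singleton.1 hz
      exact ⟨c • p₀, kSmul_mem_of_alpha_smul_mem hK P hPα c hp₀, c' • q₀,
        kSmul_mem_of_alpha_smul_mem hK Q hQα c' hq₀, rfl⟩
    · refine weilForm_isotropic_span_sup T hd hα hK hTa hTw _
        (weilForm_isotropic_span T hd hα hK hTa hTw g₂ hv2)
        g₁ hv1 fun l hl => ?_
      obtain ⟨c, rfl⟩ := Submodule.mem_span_singleton.1 hl
      exact weilForm_apply_kSmul_right_eq_zero T hK hv3 hv4 c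
  | succ k ih =>
    intro P Q hPα hQα hpos hneg hPQ hP hQ
    have hPQ0 : ∀ x ∈ P, x ∈ Q → x = 0 := fun x hxP hxQ => by
      by_contra h
      have h1 := hpos x hxP h
      rw [hPQ x hxP _ (hQα x hxQ)] at h1
      exact lt_irrefl _ h1
    have hinf : P ⊓ Q = ⊥ :=
      eq_bot_iff.2 fun x hx => (Submodule.mem_bot ℚ).2 (hPQ0 x hx.1 hx.2)
    have h5 : 5 ≤ finrank ℚ ↥(P ⊔ Q) := by
      have h := Submodule.finrank_sup_add_finrank_inf_eq P Q
      rw [hinf, finrank_bot] at h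
      omega
    have hP0 : P ≠ ⊥ := fun h => by
      rw [h, finrank_bot] at hP
      omega
    have hQ0 : Q ≠ ⊥ := fun h => by
      rw [h, finrank_bot] at hQ
      omega
    obtain ⟨p₀, hp₀, q₀, hq₀, hp₀0, hq₀0, hsum⟩ :=
      weilForm_exists_isotropic_pair hd hα E hE hW P Q hQα hpos hneg hPQ hP0 hQ0 h5
    obtain ⟨m₁, m₂, hm₁, hm₂, L', hL'rank, hL'mem, hL'iso⟩ :=
      ih (P ⊓ (LinearMap.ker (E p₀) ⊓ LinearMap.ker (E (α • p₀))))
        (Q ⊓ (LinearMap.ker (E q₀) ⊓ LinearMap.ker (E (α • q₀))))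
        (fun x hx => ⟨hPα x hx.1, weilForm_alpha_smul_mem_kPerp hd hα E hW hx.2⟩)
        (fun x hx => ⟨hQα x hx.1, weilForm_alpha_smul_mem_kPerp hd hα E hW hx.2⟩)
        (fun x hx => hpos x hx.1) (fun x hx => hneg x hx.1) (fun p hp q hq => hPQ p hp.1 q hq.1)
        (by have := finrank_le_finrank_inf_kPerp_add_two P E α p₀; omega)
        (by have := finrank_le_finrank_inf_kPerp_add_two Q E α q₀; omega)
    refine ⟨m₁, m₂, hm₁, hm₂, ?_⟩
    set cw : Fin 2 → ℚ := ![(m₁ : ℚ) * r₁, -((m₂ : ℚ) * r₂)] with hcw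
    set T := bilinOrthSum E (diagWeilForm hd hα hK (Pi.basisFun K (Fin 2)) cw) with hT
    have hpq0 : p₀ + q₀ ≠ 0 := fun h => hp₀0 (hPQ0 p₀ hp₀ (by
      rw [eq_neg_of_add_eq_zero_left h]
      exact Q.neg_mem hq₀))
    set g : V × (Fin 2 → K) := (p₀ + q₀, 0) with hg
    have hg0 : g ≠ 0 := fun h => hpq0 (congrArg Prod.fst h)
    refine ⟨Submodule.span K {g} ⊔ L', ?_, ?_, ?_⟩
    · rw [finrank_span_singleton_sup_eq L' hg0 ?_, hL'rank]
      intro c hc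
      obtain ⟨p', hp', q', hq', hpq'⟩ := hL'mem _ hc
      have e1 : c • p₀ - p' = q' - c • q₀ := by
        rw [sub_eq_sub_iff_add_eq_add, add_comm q' p', ← smul_add]
        exact hpq'
      have hmP : c • p₀ - p' ∈ P := P.sub_mem (kSmul_mem_of_alpha_smul_mem hK P hPα c hp₀) hp'.1
      have hmQ : c • p₀ - p' ∈ Q := by
        rw [e1]
        exact Q.sub_mem hq'.1 (kSmul_mem_of_alpha_smul_mem hK Q hQα c hq₀)
      have e2 : c • p₀ = p' := sub_eq_zero.1 (hPQ0 _ hmP hmQ)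
      have hcp : c • p₀ ∈ LinearMap.ker (E p₀) ⊓ LinearMap.ker (E (α • p₀)) := e2 ▸ hp'.2
      rw [mem_ker_inf_ker_smul_iff] at hcp
      exact weilForm_eq_zero_of_apply_kSmul E hK hE hW (hpos p₀ hp₀ hp₀0).ne' hcp.1 hcp.2
    · intro x hx
      obtain ⟨y, hy, l, hl, rfl⟩ := Submodule.mem_sup.1 hx
      obtain ⟨c, rfl⟩ := Submodule.mem_span_singleton.1 hy
      obtain ⟨p', hp', q', hq', hl1⟩ := hL'mem l hl
      refine ⟨c • p₀ + p', P.add_mem (kSmul_mem_of_alpha_smul_mem hK P hPα c hp₀) hp'.1,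
        c • q₀ + q',
        Q.add_mem (kSmul_mem_of_alpha_smul_mem hK Q hQα c hq₀) hq'.1, ?_⟩
      rw [Prod.fst_add, hl1, hg, Prod.smul_mk, smul_add]
      exact add_add_add_comm _ _ _ _
    · refine weilForm_isotropic_span_sup T hd hα hK
        (bilinOrthSum_diagWeilForm_swap hd hα hK E cw hE)
        (bilinOrthSum_diagWeilForm_smul_smul hd hα hK E cw hW) L' hL'iso g ?_ fun l hl => ?_
      · rw [hT, hg, Prod.smul_mk, smul_zero, bilinOrthSum_diagWeilForm_mk]
        simp only [map_zero, add_zero]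
        rw [weilForm_apply_add_alpha_add E hd hα hE hW (hPQ p₀ hp₀ _ (hQα q₀ hq₀)), hsum]
      · obtain ⟨p', hp', q', hq', hl1⟩ := hL'mem l hl
        obtain ⟨l1, l2⟩ := l
        rw [hT, hg, bilinOrthSum_diagWeilForm_mk]
        simp only [map_zero, LinearMap.zero_apply, add_zero]
        simp only at hl1
        rw [hl1]
        have e1 : E p₀ p' = 0 := (mem_ker_inf_ker_smul_iff.1 hp'.2).1
        have e2 : E p₀ q' = 0 := hPQ p₀ hp₀ q' hq'.1
        have e3 : E q₀ p' = 0 := by rw [hE, hPQ p' hp'.1 q₀ hq₀, neg_zero]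
        have e4 : E q₀ q' = 0 := (mem_ker_inf_ker_smul_iff.1 hq'.2).1
        simp only [map_add, LinearMap.add_apply, e1, e2, e3, e4, add_zero]


/-! ### The theorem, for every `d > 0` -/

/-- **Aiming arithmetic (free polarisation weights), for every `d > 0`.** Let `K ∋ α`,
`α² = -d`, `K = ℚ + ℚ α`; `V` a `K`-space of dimension `2n`; `E` an alternating `ℚ`-bilinear
form on `V` of Weil type (`E(α x, α y) = d E(x, y)`) such that `S(x, x) = E(x, α x)` is positive
on `P ∖ 0` and negative on `N ∖ 0` for `K`-subspaces `P, N` of dimension `n` with `P ⊓ N = 0`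
(signature `(n, n)`). Then for all rationals `r₁, r₂` with `r₁ r₂ > 0` there are positive
integers `m₁, m₂` and a `K`-subspace `L ⊆ V × K²` of dimension `n + 1` on which the orthogonal
sum of `E` and the diagonal Weil form with weights `(m₁ r₁, -m₂ r₂)` vanishes identically: the
Hermitian form `H ⊕ ⟨m₁ r₁, -m₂ r₂⟩` is hyperbolic (van Geemen 1994, 5.4; here from Meyer's
theorem). [cite: vanGeemen1994HodgeAV, 5.4] -/
theorem exists_isotropic_of_signature_eq (hd : 0 < d) (hα : α * α = algebraMap ℚ K (-d))
    (hK : ∀ k : K, ∃ a b : ℚ, k = algebraMap ℚ K a + algebraMap ℚ K b * α)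
    [Module.Finite K V] (n : ℕ) (hV : finrank K V = 2 * n) (E : LinearMap.BilinForm ℚ V)
    (hE : ∀ x y : V, E x y = -E y x) (hW : ∀ x y : V, E (α • x) (α • y) = d * E x y)
    (hPN : ∃ P N : Submodule K V, finrank K P = n ∧ finrank K N = n ∧ P ⊓ N = ⊥ ∧
      (∀ x ∈ P, x ≠ 0 → 0 < E x (α • x)) ∧ (∀ x ∈ N, x ≠ 0 → E x (α • x) < 0))
    (r₁ r₂ : ℚ) (hr : 0 < r₁ * r₂) :
    ∃ m₁ m₂ : ℕ, 0 < m₁ ∧ 0 < m₂ ∧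
      ∃ L : Submodule K (V × (Fin 2 → K)), finrank K L = n + 1 ∧
        ∀ x ∈ L, ∀ y ∈ L,
          bilinOrthSum E
            (diagWeilForm hd hα hK (Pi.basisFun K (Fin 2))
              ![(m₁ : ℚ) * r₁, -((m₂ : ℚ) * r₂)]) x y = 0 := by
  haveI : Module.Finite ℚ K := Module.Finite.of_basis (basisOneAlpha hd hα hK)
  haveI : Module.Finite ℚ V := Module.Finite.trans K V
  obtain ⟨P, N, hP, hN, -, hpos, hneg⟩ := hPN
  cases n with
  | zero =>
    have hq : 0 < r₂ / r₁ := by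
      rw [div_pos_iff]
      rw [mul_pos_iff] at hr
      tauto
    obtain ⟨m₁, hm₁, σ, hσ⟩ := exists_nat_mul_sq_eq_of_pos hq
    have hr₁ : r₁ ≠ 0 := fun h => by simp [h] at hr
    rw [eq_div_iff hr₁] at hσ
    refine ⟨m₁, 1, hm₁, one_pos, ?_⟩
    set g : V × (Fin 2 → K) := (0, fun i => algebraMap ℚ K (![σ, 1] i)) with hg
    have hg0 : g ≠ 0 := fun h => by
      have h1 := congrFun (congrArg Prod.snd h) 1
      simp [hg] at h1
    refine ⟨Submodule.span K {g}, finrank_span_singleton hg0, ?_⟩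
    refine weilForm_isotropic_span _ hd hα hK (bilinOrthSum_diagWeilForm_swap hd hα hK E _ hE)
      (bilinOrthSum_diagWeilForm_smul_smul hd hα hK E _ hW)
      g ?_
    rw [hg, bilinOrthSum_diagWeilForm_ratVec_alpha, smul_zero]
    simp only [map_zero, zero_add, Fin.sum_univ_two, Matrix.cons_val_zero, Matrix.cons_val_one,
      Nat.cast_one]
    linear_combination hσ
  | succ k =>
    set P' : Submodule ℚ V := P.restrictScalars ℚ with hP'
    set Q' : Submodule ℚ V := E.orthogonal P' with hQ'
    have hmemQ : ∀ v, v ∈ Q' ↔ ∀ p ∈ P, E p v = 0 := fun v =>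
      LinearMap.BilinForm.mem_orthogonal_iff
    have hP'α : ∀ x ∈ P', α • x ∈ P' := fun x hx => P.smul_mem α hx
    have hQ'α : ∀ x ∈ Q', α • x ∈ Q' := fun x hx => by
      rw [hmemQ] at hx ⊢
      intro p hp
      have h1 := apply_smul_left_of_weil E hd.ne' hα hW p x
      have h2 := hx (α • p) (P.smul_mem α hp)
      linarith
    have hPQ : ∀ p ∈ P', ∀ q ∈ Q', E p q = 0 := fun p hp q hq => (hmemQ q).1 hq p hp
    have hposP : ∀ x ∈ P', x ≠ 0 → 0 < E x (α • x) := hpos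
    have hnegQ : ∀ v ∈ Q', v ≠ 0 → E v (α • v) < 0 := fun v hv hv0 =>
      weilForm_neg_of_orthogonal hd hα hK E hE hW hV P N hP hN hpos hneg ((hmemQ v).1 hv) hv0
    have hrefl : E.IsRefl := fun x y h => by rw [hE, h, neg_zero]
    have hdisj : Disjoint P' Q' := by
      rw [Submodule.disjoint_def]
      intro x hxP hxQ
      by_contra h0
      have h1 := hpos x hxP h0
      rw [hE, (hmemQ x).1 hxQ (α • x) (P.smul_mem α hxP), neg_zero] at h1
      exact lt_irrefl _ h1
    have hcompl : IsCompl P' Q' :=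
      (LinearMap.BilinForm.isCompl_orthogonal_iff_disjoint hrefl).2 hdisj
    have hsum := Submodule.finrank_add_eq_of_isCompl hcompl
    have hKdim : finrank ℚ K = 2 := by
      simpa using finrank_eq_card_basis (basisOneAlpha hd hα hK)
    have hVdim : finrank ℚ V = 2 * (2 * (k + 1)) := by
      rw [← Module.finrank_mul_finrank ℚ K V, hKdim, hV]
    have hPdim : finrank ℚ P' = 2 * (k + 1) := by
      let e : ↥P' ≃ₗ[ℚ] ↥P :=
        { toFun := fun x => ⟨x.1, x.2⟩, invFun := fun x => ⟨x.1, x.2⟩,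
          map_add' := fun _ _ => rfl, map_smul' := fun _ _ => rfl, left_inv := fun _ => rfl,
          right_inv := fun _ => rfl }
      rw [e.finrank_eq, ← Module.finrank_mul_finrank ℚ K ↥P, hKdim, hP]
    obtain ⟨m₁, m₂, hm₁, hm₂, L, hL, -, hiso⟩ :=
      exists_isotropic_aux hd hα hK E hE hW hr k P' Q' hP'α hQ'α hposP hnegQ hPQ (by omega)
        (by omega)
    exact ⟨m₁, m₂, hm₁, hm₂, L, hL, hiso⟩

/-! ### The stub at `d = 11` -/

/-- **The aiming-arithmetic stub** of the line `generic-ppav-secant-descent` (crux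
`HeckePrymWeil.WeilTenfoldsSqrtMinus11`, item stmt-HodgeConjecture-1262): the free-weights lever
over `K = ℚ(√-11)` — the case `d = 11` of `exists_isotropic_of_signature_eq`.
[cite: vanGeemen1994HodgeAV, 5.4] -/
theorem stub_aimingArithmetic :
    ∀ (K : Type) [Field K] [Algebra ℚ K] (α : K) (hα : α * α = algebraMap ℚ K (-11))
      (hK : ∀ k : K, ∃ a b : ℚ, k = algebraMap ℚ K a + algebraMap ℚ K b * α)
      (V : Type) [AddCommGroup V] [Module ℚ V] [Module K V] [IsScalarTower ℚ K V]
      [Module.Finite K V] (n : ℕ), Module.finrank K V = 2 * n →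
    ∀ (E : LinearMap.BilinForm ℚ V), (∀ x y : V, E x y = -E y x) →
      (∀ x y : V, E (α • x) (α • y) = 11 * E x y) →
      (∃ P N : Submodule K V, Module.finrank K P = n ∧ Module.finrank K N = n ∧ P ⊓ N = ⊥ ∧
        (∀ x ∈ P, x ≠ 0 → 0 < E x (α • x)) ∧ (∀ x ∈ N, x ≠ 0 → E x (α • x) < 0)) →
    ∀ r₁ r₂ : ℚ, 0 < r₁ * r₂ →
      ∃ m₁ m₂ : ℕ, 0 < m₁ ∧ 0 < m₂ ∧
        ∃ L : Submodule K (V × (Fin 2 → K)), Module.finrank K L = n + 1 ∧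
          ∀ x ∈ L, ∀ y ∈ L,
            bilinOrthSum E
              (diagWeilForm (by norm_num : (0 : ℚ) < 11) hα hK (Pi.basisFun K (Fin 2))
                ![(m₁ : ℚ) * r₁, -((m₂ : ℚ) * r₂)]) x y = 0 := by
  intro _K _ _ _α hα hK _V _ _ _ _ _ n hV E hE hW hPN r₁ r₂ hr
  exact exists_isotropic_of_signature_eq (by norm_num) hα hK n hV E hE hW hPN r₁ r₂ hr

end Summit.HodgeConjecture.HodgeConjecture.Theorems.HeckePrymWeil

end
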